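import Summits.BirchSwinnertonDyer.BirchSwinnertonDyer.Theorems.ByReductionTypeAtTwoAdditiveKatoTransportQuadraticLayer
import HarnessLib

/-!
# Route ByReductionTypeAtTwo, crux C4″ `AdditivePotMultOverKAtTwo` (stmt-BirchSwinnertonDyer-22618; parent
# `AdditiveRankZeroAtTwo` 19098) — R17, part 2: T20 (a) «twist decomposition» in the kernel modulo the model identification
# over the quadratic layer `ℚ_∞(√−2)/ℚ_∞` — the (−2)-SPLIT-TWIST BLOCK's twin of t42 GEN 23's `hdec_of_model` /
# `isTorsion_model_iff` / `lengthAt_selmerDual_symm_of_model` (`…AdditiveKatoTransportQuadraticLayer`, p700277: `θ = √−1`), with the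
# complex-conjugation lemma proved for every `d < 0` (theorems only)

Cell `bsd-2adic`, seat `bsd-2adic-k4-w3` GEN 5. t42 GEN 23's file fixes `θ = √−1` in its §1 (`exists_sqrt_neg_one`,
`exists_mem_kerSubgroup_smul_sqrt_eq_neg`) and hence in §2–§3, while the Literature layer it rests on
(`QuadraticLayer.lengthAt_eq_add_of_quadraticLayer`, `…isTorsion_iff_of_quadraticLayer`, p699771) is stated for ANY `d ≠ 0`
given an element `c ∈ ker κ` with `c·√d = −√d`. For `d < 0` a complex conjugation is such a `c` (`(ι √d)² = d < 0` forces
`ι √d ∈ iℝ`, so `conj` negates it), for every `ℤ_p`-extension `κ` of `ℚ` (`c² = 1` and `ℤ_p` is torsion-free). Hence: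

* §1 `exists_sqrt`, `conj_eq_neg_of_sq_eq_neg` (a complex number with negative real square is negated by `conj`),
  **`exists_mem_kerSubgroup_smul_sqrt_eq_neg_of_neg`** (`d < 0`).
* §2 **`hdec_of_model_negTwo`**: `ℓ_𝔮(D_F.X) = ℓ_𝔮(X(E″/ℚ_∞)) + ℓ_𝔮(X(E/ℚ_∞))` at every height-one `𝔮 ∌ C 2` for
  `V • W = W′^{(−2)}`, `θ² = −2`, `γ·θ = θ`, and any dual datum `D_F` whose Selmer group is identified (`ΘS`, `conj`-compatibly)
  with the tree's subgroup model `W′.selmerGroupOver 2 (kerStab κ θ)` of `Sel(E″/ℚ_∞(θ))` (the `∀ 𝔮` binder shape `hdec` of GEN 4's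
  (−2) decomposition door); **`isTorsion_model_negTwo`**.
* §3 **`lengthAt_selmerDual_symm_of_model_negTwo`**: T20 (f) BY NAME — `ℓ_𝔮(X(E/ℚ_∞)) = ℓ_{ι𝔮}(X(E/ℚ_∞))` at every height-one
  `𝔮 ∌ 2` for the ADDITIVE `E = W` of the (−2)-block — from Greenberg's Thm. 1.14 over `ℚ` and over `F` (the tree's two PRINT
  facts, `W′` multiplicative at `2` and split multiplicative above `2` over `F`, intended `F = ℚ(√−2)`), the torsion of
  `X(E″/ℚ_∞)` and `X(E/ℚ_∞)`, and the model identification.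

HONEST FRAMING (D-0036 / D-0054): theorems only — no definition, no named fact, no instance, no `sorry`; route-independent;
CONDITIONAL on the displayed model identification `ΘS` (Selmer base change along `ℚ(√d)/ℚ` at the infinite level — t42
GEN 24's lane, `…AdditiveSelmerBaseChangeModelIso`) and on Greenberg's Thm. 1.14 ×2 taken as hypotheses BY NAME;
types-the-object-of; closes none; nothing booked; BSD is not proved by any of this. PARTITION: X5@2 additive potentially-
multiplicative block, the (−1)- and (−2)-split-twist sub-blocks × `p = 2`.

References: [GreenbergLNM1716] §1 p. 60, Thm. 1.14 p. 68, §4 p. 107; [DokchitserDokchitserAnnals2010] Lemma 4.14;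
[Washington1997] §13.1; memo `run/shared/lean/pub/bsd-2adic/t42/DESIGN-T42-ADDENDUM-27.md`.
-/

set_option autoImplicit false
-- the summit's namespace `Summit.BirchSwinnertonDyer.BirchSwinnertonDyer` (Sub = Summit) trips `dupNamespace`
set_option linter.dupNamespace false

noncomputable section

open scoped Classical MatrixGroups ModularForm NumberField

open Field CongruenceSubgroup WeierstrassCurve IsDedekindDomain
  Literature.NumberTheory.EllipticCurves Literature.NumberTheory.EllipticCurves.ModularForms
  Literature.NumberTheory.EllipticCurves.Module Literature.NumberTheory.EllipticCurves.QuadraticLayer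
  Literature.NumberTheory.GaloisRepresentations

namespace Summit.BirchSwinnertonDyer.BirchSwinnertonDyer.Theorems.AddKatoTwoQuadLayer

universe v

/-! ## §1 The imaginary quadratic layer `ℚ_∞(√d)/ℚ_∞`, `d < 0`: a complex conjugation in `ker κ` negates `√d` -/

/-- `√d ∈ ℚ̄` for every `d : ℚ`. [folklore] -/
theorem exists_sqrt (d : ℚ) : ∃ θ : AlgebraicClosure ℚ, θ ^ 2 = algebraMap ℚ (AlgebraicClosure ℚ) d := by
  obtain ⟨θ, hθ⟩ := IsAlgClosed.exists_eq_mul_self (algebraMap ℚ (AlgebraicClosure ℚ) d)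
  exact ⟨θ, by rw [sq, ← hθ]⟩

/-- A complex number whose square is a NEGATIVE real is purely imaginary: `conj z = −z`. [folklore] -/
theorem conj_eq_neg_of_sq_eq_neg {z : ℂ} {d : ℝ} (hd : d < 0) (hz : z ^ 2 = (d : ℂ)) : starRingEnd ℂ z = -z := by
  have hre : (z ^ 2).re = d := by rw [hz, Complex.ofReal_re]
  have him : (z ^ 2).im = 0 := by rw [hz, Complex.ofReal_im]
  rw [sq, Complex.mul_re] at hre
  rw [sq, Complex.mul_im] at him
  have hzre : z.re = 0 := by
    rcases mul_eq_zero.mp (show z.re * z.im = 0 by linarith) with h | h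
    · exact h
    · exfalso
      rw [h, mul_zero, sub_zero] at hre
      nlinarith [mul_self_nonneg z.re]
  apply Complex.ext
  · simp [hzre]
  · simp

/-- **A complex conjugation lies in `ker κ` and negates `√d` for `d < 0`**: for ANY `ℤ_p`-extension `κ` of `ℚ` and
`θ² = d < 0` there is `c ∈ ker κ` with `c·θ = −θ` — a complex conjugation `c` (tree: `exists_isComplexConjugation`) has
`c² = 1`, so `2·κ(c) = 0` in the torsion-free `ℤ_p`, and under an embedding `ι : ℚ̄ → ℂ` extending `ℚ ⊂ ℝ`,
`ι(cθ) = conj(ι θ) = −ι θ` because `(ι θ)² = d < 0`. Generalises t42 GEN 23's `exists_mem_kerSubgroup_smul_sqrt_eq_neg`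
(`d = −1`). [cite: Washington1997, §13.1] -/
theorem exists_mem_kerSubgroup_smul_sqrt_eq_neg_of_neg {p : ℕ} [Fact p.Prime] (κ : ZpExtension ℚ p) {d : ℚ} (hd : d < 0)
    {θ : AlgebraicClosure ℚ} (hθ : θ ^ 2 = algebraMap ℚ (AlgebraicClosure ℚ) d) :
    ∃ c : absoluteGaloisGroup ℚ, c ∈ κ.kerSubgroup ∧ c • θ = -θ := by
  obtain ⟨c, hc⟩ := exists_isComplexConjugation (Rat.castHom ℝ)
  obtain ⟨ι, -, hι⟩ := isComplexConjugation_iff.mp hc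
  refine ⟨c, ?_, ?_⟩
  · -- `c² = 1`, `ℤ_p` torsion-free
    rw [ZpExtension.mem_kerSubgroup]
    have h2 : orderOf c = 2 := hc.orderOf_eq_two
    have hcc : c * c = 1 := by rw [← pow_two, ← h2, pow_orderOf_eq_one]
    have hκ : κ c * κ c = 1 := by rw [← map_mul, hcc, map_one]
    have hadd : (κ c).toAdd + (κ c).toAdd = 0 := by
      rw [← toAdd_mul, hκ, toAdd_one]
    have h0 : (κ c).toAdd = 0 := by
      rw [← two_mul] at hadd
      rcases mul_eq_zero.mp hadd with h | h
      · exfalso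
        have h2' : (2 : ℤ_[p]) = ((2 : ℕ) : ℤ_[p]) := by norm_num
        rw [h2'] at h
        exact (Nat.cast_ne_zero.mpr (by norm_num : (2 : ℕ) ≠ 0)) h
      · exact h
    exact Multiplicative.toAdd.injective (by rw [h0, toAdd_one])
  · -- `ι (c θ) = conj (ι θ) = -ι θ`
    have hιd : ι (algebraMap ℚ (AlgebraicClosure ℚ) d) = ((d : ℝ) : ℂ) := by simp
    have hθ2 : (ι θ) ^ 2 = ((d : ℝ) : ℂ) := by rw [← map_pow, hθ, hιd]
    have hconj : starRingEnd ℂ (ι θ) = -ι θ := conj_eq_neg_of_sq_eq_neg (by exact_mod_cast hd) hθ2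
    apply ι.injective
    rw [hι θ, hconj, map_neg]

/-! ## §2 The decomposition reading `hdec` for `d < 0`, modulo the model identification -/

section Model

variable (κ : ZpExtension ℚ 2) (W' W : WeierstrassCurve ℚ) {V : VariableChange ℚ}
  (hV : V • W = W'.quadraticTwist (-2))
  {θ : AlgebraicClosure ℚ} (hθ : θ ^ 2 = algebraMap ℚ (AlgebraicClosure ℚ) (-2))
  {γ : absoluteGaloisGroup ℚ} (hγθ : γ • θ = θ)
  -- the model: ANY base field `F`, curve `WF/F`, tower `κF`, generator `γF`, and an identification of Selmer groups
  {F : Type v} [Field F] [NumberField F] {WF : WeierstrassCurve F} {κF : ZpExtension F 2}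
  {γF : absoluteGaloisGroup F} [(kerStab κ θ).Normal]
  (ΘS : WF.selmerInfty κF ≃+ W'.selmerGroupOver 2 (kerStab κ θ))
  (hΘS : ∀ s, ((ΘS (WF.conjSelmerInfty κF γF s) : W'.selmerGroupOver 2 (kerStab κ θ)) : W'.subgroupH1 2 (kerStab κ θ)) =
    W'.conjH1 2 (kerStab κ θ) γ (ΘS s : W'.selmerGroupOver 2 (kerStab κ θ)))
  (D' : W'.SelmerDualData κ γ) (D : W.SelmerDualData κ γ) (DF : WF.SelmerDualData κF γF)

/-- `(2 : Λ) = C 2`. [folklore] -/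
private theorem two_eq_C : (2 : IwasawaAlgebra 2) = PowerSeries.C (2 : ℤ_[2]) := by
  rw [show (2 : ℤ_[2]) = ((2 : ℕ) : ℤ_[2]) by norm_num, map_natCast]; norm_num

include hV hθ hγθ hΘS in
/-- **THE DECOMPOSITION READING `hdec` OF T20 (f), KERNEL modulo the model identification, for the (−2)-block**
(`θ = √−2`, quadratic layer `ℚ_∞(√−2)/ℚ_∞`): `ℓ_𝔮(D_F.X) = ℓ_𝔮(X(E″/ℚ_∞)) + ℓ_𝔮(X(E/ℚ_∞))` at every prime `𝔮 ∌ C 2` of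
`Λ = ℤ₂⟦T⟧`, for `E″ = W′`, `E = W` a `ℚ`-model of `E″^{(−2)}`, `γ` fixing `θ` (WLOG: `SelmerDualData.rekey`), and ANY dual datum
`D_F` whose Selmer group is identified with the subgroup model of `Sel(E″/ℚ_∞(θ))` compatibly with `conj` — the (−2)-twin of
t42 GEN 23's `hdec_of_model` (`θ = √−1`), in the `∀ 𝔮` shape of the binder `hdec` of
`AddKatoTwo.lengthAt_selmerDual_le_of_oddBranchInputsNegTwoPrintExactAnyImage_of_decomposition_fe`.
[cite: GreenbergLNM1716, §4 p. 107] [cite: DokchitserDokchitserAnnals2010, Lemma 4.14] -/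
theorem hdec_of_model_negTwo :
    ∀ 𝔮 : PrimeSpectrum (IwasawaAlgebra 2), 𝔮.asIdeal.height = 1 → PowerSeries.C (2 : ℤ_[2]) ∉ 𝔮.asIdeal →
      lengthAt (IwasawaAlgebra 2) DF.X 𝔮 =
        lengthAt (IwasawaAlgebra 2) D'.X 𝔮 + lengthAt (IwasawaAlgebra 2) D.X 𝔮 := by
  intro 𝔮 _ hp𝔮
  have hd : (-2 : ℚ) < 0 := by norm_num
  obtain ⟨c, hcκ, hcθ⟩ := exists_mem_kerSubgroup_smul_sqrt_eq_neg_of_neg κ hd hθ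
  exact lengthAt_eq_add_of_quadraticLayer κ W' W hd.ne hV hθ hcκ hcθ hγθ ΘS hΘS D' D DF 𝔮 (by rw [two_eq_C]; exact hp𝔮)

include hγθ hΘS hV hθ in
/-- **Torsion passes TO the model over `ℚ(√−2)`** (the (−2)-block): `X(E″/ℚ_∞)` and `X(E/ℚ_∞)` torsion ⟹ `D_F` torsion.
[cite: DokchitserDokchitserAnnals2010, Lemma 4.14] -/
theorem isTorsion_model_negTwo (hD' : D'.IsTorsion) (hD : D.IsTorsion) : DF.IsTorsion := by
  have hd : (-2 : ℚ) < 0 := by norm_num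
  obtain ⟨c, hcκ, hcθ⟩ := exists_mem_kerSubgroup_smul_sqrt_eq_neg_of_neg κ hd hθ
  exact (isTorsion_iff_of_quadraticLayer κ W' W hd.ne hV hθ hcκ hcθ hγθ ΘS hΘS D' D DF).mpr ⟨hD', hD⟩

end Model

/-! ## §3 T20 (a) for `d < 0`: the `ι`-symmetry of the height-one lengths of `X(E/ℚ_∞)` for the additive curve -/

section Symmetry

variable (W' : WeierstrassCurve ℚ) [W'.IsElliptic] [W'.IsGloballyMinimal] (hmult' : W'.HasMultiplicativeReductionAtPrime 2)
  (W : WeierstrassCurve ℚ) {V : VariableChange ℚ} (hV : V • W = W'.quadraticTwist (-2))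
  {θ : AlgebraicClosure ℚ} (hθ : θ ^ 2 = algebraMap ℚ (AlgebraicClosure ℚ) (-2))
  (κ : ZpExtension ℚ 2) (γ : absoluteGaloisGroup ℚ) (hκ : κ.IsCyclotomic) (hγ : κ.IsTopGenerator γ) (hγθ : γ • θ = θ)
  (D' : W'.SelmerDualData κ γ) [Module.Finite (IwasawaAlgebra 2) D'.X] (hD' : D'.IsTorsion)
  (D : W.SelmerDualData κ γ) (hD : D.IsTorsion)
  -- the model of `Sel(E″/ℚ_∞(θ))` over a number field `F` where `E″` is split multiplicative above `2` (intended `F = ℚ(√−2)`)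
  (F : Type) [Field F] [NumberField F]
  (hF : ∀ v : HeightOneSpectrum (𝓞 F), (2 : 𝓞 F) ∈ v.asIdeal → (W'.baseChange F).HasSplitMultiplicativeReductionAt v)
  (κF : ZpExtension F 2) (γF : absoluteGaloisGroup F) (hκF : κF.IsCyclotomic) (hγF : κF.IsTopGenerator γF)
  (DF : (W'.baseChange F).SelmerDualData κF γF) [Module.Finite (IwasawaAlgebra 2) DF.X] [(kerStab κ θ).Normal]
  (ΘS : (W'.baseChange F).selmerInfty κF ≃+ W'.selmerGroupOver 2 (kerStab κ θ))
  (hΘS : ∀ s, ((ΘS ((W'.baseChange F).conjSelmerInfty κF γF s) : W'.selmerGroupOver 2 (kerStab κ θ)) :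
      W'.subgroupH1 2 (kerStab κ θ)) = W'.conjH1 2 (kerStab κ θ) γ (ΘS s : W'.selmerGroupOver 2 (kerStab κ θ)))

include hmult' hV hθ hκ hγ hγθ hD' hD hF hκF hγF DF hΘS in
/-- **T20 (f) BY NAME with `hdec` DISCHARGED, (−2)-block: `ℓ_𝔮(X(E/ℚ_∞)) = ℓ_{ι𝔮}(X(E/ℚ_∞))` at EVERY height-one `𝔮 ∌ 2`** for
the ADDITIVE curve `E = W` (`W` a `ℚ`-model of `E″^{(−2)}`, `E″ = W′` multiplicative at `2`), from Greenberg's Thm 1.14 over `ℚ`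
(for `X(E″/ℚ_∞)`) and over `F` (for `X((E″)_F/F_∞)`, `E″` split multiplicative above `2`; intended `F = ℚ(√−2)`) — the tree's two
PRINT facts, hypotheses BY NAME — the torsion of `X(E″/ℚ_∞)`, `X(E/ℚ_∞)`, and the model identification `ΘS` over the quadratic
layer `ℚ_∞(√−2)/ℚ_∞`. Kernel: `hdec_of_model_negTwo`, `isTorsion_model_negTwo`, then `AddKatoTwo.lengthAt_selmerDual_symm_of_decomposition`.
The (−2)-twin of t42 GEN 23's `lengthAt_selmerDual_symm_of_model` (`θ = √−1`), in `∀ 𝔮` shape.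
[cite: GreenbergLNM1716, Thm. 1.14 (p. 68) and §1 (p. 60)] [cite: DokchitserDokchitserAnnals2010, Lemma 4.14] -/
theorem lengthAt_selmerDual_symm_of_model_negTwo (h114 : Greenberg1999_thm114_charIdeal_iota_invariant)
    (h114F : Greenberg1999.thm114_charIdeal_iota_invariant_splitMult_baseChange) :
    ∀ 𝔮 : PrimeSpectrum (IwasawaAlgebra 2), 𝔮.asIdeal.height = 1 → PowerSeries.C (2 : ℤ_[2]) ∉ 𝔮.asIdeal →
      lengthAt (IwasawaAlgebra 2) D.X 𝔮 =
        lengthAt (IwasawaAlgebra 2) D.X (PrimeSpectrum.comap (IwasawaAlgebra.invol 2).toRingHom 𝔮) := by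
  intro 𝔮 h𝔮 hp𝔮
  have hDF : DF.IsTorsion := isTorsion_model_negTwo κ W' W hV hθ hγθ ΘS hΘS D' D DF hD' hD
  exact AddKatoTwo.lengthAt_selmerDual_symm_of_decomposition h114 h114F W' hmult' F hF κF γF hκF hγF DF hDF κ γ hκ hγ
    D' hD' D (hdec_of_model_negTwo κ W' W hV hθ hγθ ΘS hΘS D' D DF) 𝔮 h𝔮 hp𝔮

end Symmetry

end Summit.BirchSwinnertonDyer.BirchSwinnertonDyer.Theorems.AddKatoTwoQuadLayer

end
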